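/-
Copyright (c) 2026 the pub-hodgecm-mathlib formalisation cell (harness21).  Prover seat hodgecm-mathlib-K2E1-p14 (g4), Track B ∕ K2-LIT, h413 = `stmt-HodgeConjecture-24833`,
R90-TF section S8 «ContSpec-n½», socket (E) `sock_S8_res_exhaustion_le_closure` (B ED. 7 :276) via ★ `res_exhaustion_le_closure_of_record`: THE PER-K-TYPE GLUE of the (N₃) row —
the whole-block letter `hNblk Kf b` («`W ⊓ Fix(ι_f Kf) ⟂ Sc ⊓ (span eTop ⊔ span eMid)ᗮ`») FROM its `K_∞`-type pieces («`W ⊓ (Fix(ι_f Kf) ⊓ N_τ) ⟂ …` for every irreducible closed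
`K_∞`-subrepresentation `τ`», ★ F1_qs's `Iso i` granularity), by Peter–Weyl inside the closed `K_∞`-stable space `W ⊓ Fix(ι_f Kf)` (S8 dealer R90-CS-plan (g3) S8-R189 «then the per-τ
GLUE file»; census `K2/K2E1-p14/g4/CENSUS-E4-PlancherelEstate.K2E1-p14-g4.md` row (1), K-type currency flag BOOKED).
-/
import Summits.HodgeConjecture.HodgeConjecture.Theorems.R90S8ResGIsotypicDensityU3      -- ★ p862817 (K2E1-p14 (g3)): `le_topologicalClosure_iSup_inf_isotypicComponent_of_invariant` (Peter–Weyl on a closed stable subspace), `compactSpace_arch_inf_unitaryOne`, `continuous_inclusion_arch_inf_unitaryOne`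
import Summits.HodgeConjecture.HodgeConjecture.Theorems.R90S8ResGBlockDataU3Defs          -- ★ G-DEFS (K2E1-p11): `resGBlock`
import Summits.HodgeConjecture.HodgeConjecture.Theorems.K2E1CuspidalSpectrumUnitaryDefs   -- ★ `residualSubspace`
import HarnessLib

/-!
# S8 (E) road — `R90S8ResGIsotypicKTypeGlueU3`: the (N₃) letter of a block FROM ITS `K_∞`-TYPE PIECES — Peter–Weyl inside `W ⊓ Fix(ι_f Kf)` (every datum `(F, E, c, N, J)`, every compact
# Hausdorff `K →* U(J)(E ⊗ ℝ)`; at the index of record of `U(J₃)_{L∕L⁺}` in ★ `res_exhaustion_le_closure_of_record`'s `hNblk` bytes)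

Track B ∕ K2-LIT, crux h413 = `stmt-HodgeConjecture-24833`, route of record `HCCMUnconditional`; cell `hodgecm-mathlib`, R90-TF programme, section S8 «ContSpec-n½», socket (E)
(B ED. 7 :276) through ★ `res_exhaustion_le_closure_of_record` (K2E1-p14 (g4)) whose (N₃) row is the whole-block letter `hNblk Kf b` — paid, per the booked K-TYPE CURRENCY FLAG
(S8-R189: the D5′ projector `π_K(χK) ∘ R_f(e)` with a multiplicative or χ_τ-idempotent kernel sees ONE `K_∞`-type at a time), PIECE BY PIECE over the `K_∞`-types and GLUED here.
THEOREMS ONLY (no `def`, no `instance`, no `notation`, no named-fact hypothesis, no `sorry`; default heartbeats); lane `--supports stmt-HodgeConjecture-24833 --as helper` (count-neutral).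
CLOSES NO SOCKET.

THE MATHEMATICS ([BrockerTomDieck1985, III (5.7), Thm. (5.10)]; [DeitmarEchterhoff2014, Thm. 7.2.3, §7.3]; [BorelJacquet1979, §4.1, §4.6]).  Let `W ≤ L²` be a closed `G(𝔸)`-stable
subspace and `Kf ≤ G(𝔸_f)` any subgroup.  Since `ι_∞(k)` and `ι_f(u)` commute (★ `commute_archToAdelic_finAdelicToAdelic`), the closed subspace `W ⊓ Fix(ι_f Kf)` is stable under the compact
group `K` acting through `ρ = R ∘ ι_∞ ∘ κ`; by Peter–Weyl (★ `le_topologicalClosure_iSup_inf_isotypicComponent_of_invariant`) it lies in the closure of the span of its isotypic pieces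
`(W ⊓ Fix(ι_f Kf)) ⊓ N_τ`, `τ` over the irreducible closed subrepresentations of `ρ`.  Hence if every piece lies in a CLOSED subspace `T` — e.g. the orthocomplement `(Sc ⊓ Aᗮ)ᗮ` of the line
part of a block — so does `W ⊓ Fix(ι_f Kf)`.  (This is the step (2) of ★ (D₃) `le_topologicalClosure_iSup_inf_fix_inf_isotypicComponent`, isolated for an arbitrary closed subrepresentation
and a fixed level.)
* §1 **`inf_fix_le_topologicalClosure_iSup_inf_isotypicComponent`** — every datum: `W ⊓ Fix(ι_f Kf) ≤ closure ⨆_τ (W ⊓ Fix(ι_f Kf)) ⊓ N_τ`.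
* §2 **`inf_fix_le_of_forall_kType`** — every datum: if `W ⊓ (Fix(ι_f Kf) ⊓ N_τ) ≤ T` for all `τ` and `T` is closed, then `W ⊓ Fix(ι_f Kf) ≤ T`.
* §3 **`hNblk_of_kTypes`** — at `U(J₃)_{L∕L⁺}`, the `K_∞` OF RECORD (`κ` = the inclusion `U(J₃)(L⁺⊗ℝ) ∩ U(1⊗1) ↪ U(J₃)(L⁺⊗ℝ)`) and the index of record `Kf`: the `hNblk Kf b` BYTES of ★
  `res_exhaustion_le_closure_of_letters` ∕ `…_of_record` (residue space `A`, e.g. `span (range eTop) ⊔ span (range eMid)`) FROM the per-`K_∞`-type letters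
  `hτ : ∀ τ W, irreducible → W ≤ L²_res(𝔓) → W ⊓ (Fix(ι_f Kf) ⊓ N_τ) ≤ (Sc ⊓ Aᗮ)ᗮ` — ★ F1_qs's own `Iso i = Fix(ι_f Kf) ⊓ N_τ` granularity, the shape the 1-dim-type road (★ p863747 §2 at
  a `Kad`-type level datum) and the reserved χ_τ-idempotent edition (`R90S8ResGIsotypicTauIdempotentModelU3`) pay.
HONEST LABEL: HC_CM is proved only modulo the 7 printed citations (2 remaining named inputs: hLiu418 = `stmt-HodgeConjecture-24832`, h413 = `stmt-HodgeConjecture-24833`) until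
rung 0 closes; REL ≠ ★ ≠ BUILT; this file asserts no named fact, is conditional on its visible per-type letters, and closes no socket; count-neutral.

## References
* [BrockerTomDieck1985] T. Bröcker, T. tom Dieck, *Representations of Compact Lie Groups*, GTM 98 (1985), III (5.7), Thm. (5.10).
* [DeitmarEchterhoff2014] A. Deitmar, S. Echterhoff, *Principles of Harmonic Analysis* (2nd ed., 2014), Thm. 7.2.3, §7.3.
* [BorelJacquet1979] A. Borel, H. Jacquet, *Automorphic forms and automorphic representations*, PSPM 33.1 (1979), §4.1, §4.6.
-/

set_option autoImplicit false
set_option linter.dupNamespace false  -- the mandated namespace `…HodgeConjecture.HodgeConjecture.R90.S8` (LEAD #1 L1) repeats the summit's segment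

noncomputable section

open MeasureTheory Filter Topology NumberField ContRepresentation Set
open scoped InnerProductSpace ENNReal NNReal
open Literature.NumberTheory.Automorphic Literature.NumberTheory.Automorphic.UnitaryGroup Literature.NumberTheory.GaloisRepresentations AdelicGroupData
open Literature.NumberTheory.Automorphic.Arthur2013.Leaves.TECR
open Summit.HodgeConjecture.HodgeConjecture.Cruxes.H413.K2E1CuspidalSpectrumUnitary (residualSubspace)

namespace Summit.HodgeConjecture.HodgeConjecture.R90.S8

/-! ## §1–§2 Every datum: Peter–Weyl inside `W ⊓ Fix(ι_f Kf)` -/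

section Adelic

variable {F E : Type} [Field F] [NumberField F] [Field E] [NumberField E] [Algebra F E] {c : E ≃ₐ[F] E} {N : ℕ} {J : Matrix (Fin N) (Fin N) E}
  (μ : Measure (adelicGroupData F E c N J).automorphicQuotient) [(adelicGroupData F E c N J).IsAutomorphicMeasure μ]
  {K : Type*} [Group K] [TopologicalSpace K] [IsTopologicalGroup K] [CompactSpace K] [T2Space K] (κ : K →* arch F E c N J)

/-- **PETER–WEYL INSIDE `W ⊓ Fix(ι_f Kf)`**: for a closed `G(𝔸)`-stable `W ≤ L²`, any subgroup `Kf ≤ U(J)(𝔸_{F,f})` and any compact Hausdorff `K` with a continuous `κ : K →* U(J)(E ⊗ ℝ)`,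
`W ⊓ Fix(ι_f Kf) ≤ closure ⨆_τ (W ⊓ Fix(ι_f Kf)) ⊓ ρ.isotypicComponent τ` (`ρ = R ∘ ι_∞ ∘ κ`, `τ` over the irreducible closed subrepresentations of `ρ`) — the piece is closed and
`K`-stable (`ι_∞(κ k)` commutes with `ι_f(u)`, ★ `commute_archToAdelic_finAdelicToAdelic`), and ★ `le_topologicalClosure_iSup_inf_isotypicComponent_of_invariant` applies (`R` unitary, strongly
continuous ★). [cite: BrockerTomDieck1985, III (5.7), Thm. (5.10)] [cite: BorelJacquet1979, §4.1, §4.6] -/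
theorem inf_fix_le_topologicalClosure_iSup_inf_isotypicComponent (hκc : Continuous κ)
    (W : ClosedSubrep ((adelicGroupData F E c N J).rightRegular μ)) (Kf : Subgroup (finAdelic F E c N J)) :
    W.toSubmodule ⊓ (⨅ u : ↥(Kf), Module.End.eigenspace ((((adelicGroupData F E c N J).rightRegular μ) (finAdelicToAdelic F E c N J (u : finAdelic F E c N J)) :
        (adelicGroupData F E c N J).L2 μ →L[ℂ] (adelicGroupData F E c N J).L2 μ) : (adelicGroupData F E c N J).L2 μ →ₗ[ℂ] (adelicGroupData F E c N J).L2 μ) 1) ≤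
      (⨆ U : {U : ClosedSubrep (((adelicGroupData F E c N J).rightRegular μ).restrict ((archToAdelic F E c N J).comp κ)) // U.toContRep.IsTopIrreducible},
        (W.toSubmodule ⊓ (⨅ u : ↥(Kf), Module.End.eigenspace ((((adelicGroupData F E c N J).rightRegular μ) (finAdelicToAdelic F E c N J (u : finAdelic F E c N J)) :
        (adelicGroupData F E c N J).L2 μ →L[ℂ] (adelicGroupData F E c N J).L2 μ) : (adelicGroupData F E c N J).L2 μ →ₗ[ℂ] (adelicGroupData F E c N J).L2 μ) 1)) ⊓ (((((adelicGroupData F E c N J).rightRegular μ).restrict ((archToAdelic F E c N J).comp κ))).isotypicComponent U.1.toContRep).toSubmodule).topologicalClosure := by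
  have hU := (adelicGroupData F E c N J).isUnitary_rightRegular μ
  have hS := (adelicGroupData F E c N J).isStronglyContinuous_rightRegular_holds μ
  refine le_topologicalClosure_iSup_inf_isotypicComponent_of_invariant (σ := (((adelicGroupData F E c N J).rightRegular μ).restrict ((archToAdelic F E c N J).comp κ))) (fun k => hU _)
    (fun v => (hS v).comp ((continuous_archToAdelic F E c N J).comp hκc)) _ ?_ ?_
  · -- closed
    rw [Submodule.coe_inf, Submodule.coe_iInf]
    exact W.isClosed.inter (isClosed_iInter fun u => ContinuousLinearMap.isClosed_eigenspace _ _)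
  · -- `K`-stable: `R(ι_f u) (R(ι_∞ κ k) v) = R(ι_∞ κ k) (R(ι_f u) v) = R(ι_∞ κ k) v`
    rintro k v ⟨hvW, hvFix⟩
    refine ⟨W.apply_mem _ hvW, (Submodule.mem_iInf _).2 fun u => Module.End.mem_eigenspace_iff.2 ?_⟩
    have hu : ((adelicGroupData F E c N J).rightRegular μ) (finAdelicToAdelic F E c N J (u : finAdelic F E c N J)) v = v :=
      (Module.End.mem_eigenspace_iff.1 ((Submodule.mem_iInf _).1 hvFix u)).trans (one_smul ℂ v)
    rw [one_smul, ContinuousLinearMap.coe_coe, ContRepresentation.restrict_apply, MonoidHom.coe_comp, Function.comp_apply]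
    change (((adelicGroupData F E c N J).rightRegular μ) (finAdelicToAdelic F E c N J (u : finAdelic F E c N J)) * ((adelicGroupData F E c N J).rightRegular μ) (archToAdelic F E c N J (κ k))) v =
      ((adelicGroupData F E c N J).rightRegular μ) (archToAdelic F E c N J (κ k)) v
    rw [← map_mul ((adelicGroupData F E c N J).rightRegular μ), ← (commute_archToAdelic_finAdelicToAdelic F E c N J (κ k) (u : finAdelic F E c N J)).eq, map_mul]
    change ((adelicGroupData F E c N J).rightRegular μ) (archToAdelic F E c N J (κ k)) (((adelicGroupData F E c N J).rightRegular μ) (finAdelicToAdelic F E c N J (u : finAdelic F E c N J)) v) = _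
    rw [hu]

/-- **THE GLUE**: if every `K`-type piece `W ⊓ (Fix(ι_f Kf) ⊓ N_τ)` lies in a CLOSED subspace `T`, then `W ⊓ Fix(ι_f Kf) ≤ T` (§1 + minimality of the closure). [cite: BrockerTomDieck1985, III Thm. (5.10)] -/
theorem inf_fix_le_of_forall_kType (hκc : Continuous κ)
    (W : ClosedSubrep ((adelicGroupData F E c N J).rightRegular μ)) (Kf : Subgroup (finAdelic F E c N J))
    (T : Submodule ℂ ((adelicGroupData F E c N J).L2 μ)) (hT : IsClosed (T : Set ((adelicGroupData F E c N J).L2 μ)))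
    (hτ : ∀ U : {U : ClosedSubrep (((adelicGroupData F E c N J).rightRegular μ).restrict ((archToAdelic F E c N J).comp κ)) // U.toContRep.IsTopIrreducible},
      W.toSubmodule ⊓ ((⨅ u : ↥(Kf), Module.End.eigenspace ((((adelicGroupData F E c N J).rightRegular μ) (finAdelicToAdelic F E c N J (u : finAdelic F E c N J)) :
        (adelicGroupData F E c N J).L2 μ →L[ℂ] (adelicGroupData F E c N J).L2 μ) : (adelicGroupData F E c N J).L2 μ →ₗ[ℂ] (adelicGroupData F E c N J).L2 μ) 1) ⊓ (((((adelicGroupData F E c N J).rightRegular μ).restrict ((archToAdelic F E c N J).comp κ))).isotypicComponent U.1.toContRep).toSubmodule) ≤ T) :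
    W.toSubmodule ⊓ (⨅ u : ↥(Kf), Module.End.eigenspace ((((adelicGroupData F E c N J).rightRegular μ) (finAdelicToAdelic F E c N J (u : finAdelic F E c N J)) :
        (adelicGroupData F E c N J).L2 μ →L[ℂ] (adelicGroupData F E c N J).L2 μ) : (adelicGroupData F E c N J).L2 μ →ₗ[ℂ] (adelicGroupData F E c N J).L2 μ) 1) ≤ T := by
  refine (inf_fix_le_topologicalClosure_iSup_inf_isotypicComponent μ κ hκc W Kf).trans (Submodule.topologicalClosure_minimal _ (iSup_le fun U => ?_) hT)
  rw [inf_assoc]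
  exact hτ U

end Adelic

/-! ## §3 At `U(J₃)_{L∕L⁺}`, the `K_∞` of record, the index of record: the `hNblk` bytes from the per-type letters -/

section Record

variable (L : Type) [Field L] [NumberField L] [IsCMField L]
  (μ : Measure (quasiSplit (↥(maximalRealSubfield L)) L (IsCMField.complexConj L) 3).automorphicQuotient) [(quasiSplit (↥(maximalRealSubfield L)) L (IsCMField.complexConj L) 3).IsAutomorphicMeasure μ]

/-- **THE (N₃) LETTER OF A BLOCK FROM ITS `K_∞`-TYPE PIECES.**  At `U(J₃)_{L∕L⁺}` with `K_∞ = U(J₃)(L⁺⊗ℝ) ∩ U(1⊗1)` (compact ★, through the κ OF RECORD), the index of record `Kf` (open, `≤ K₀`), a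
Borel datum `(χ₁, χ₂)`, the block `Sc = resGBlock L μ (ι_f Kf) 1 χ₁ χ₂` and ANY residue space `A` (the consumer's `span (range eTop) ⊔ span (range eMid)`): if for EVERY irreducible closed
`K_∞`-subrepresentation `τ` and every irreducible residual `W`, the piece `W ⊓ (Fix(ι_f Kf) ⊓ N_τ)` is orthogonal to the line part `Sc ⊓ Aᗮ` (the per-type letter `hτ` — ★ F1_qs's `Iso i`
granularity, payable by D5′ one `K_∞`-type at a time), then the WHOLE-BLOCK letter holds: `W ⊓ Fix(ι_f Kf) ≤ (Sc ⊓ Aᗮ)ᗮ` — the `hNblk Kf b` bytes of ★ `res_exhaustion_le_closure_of_letters` ∕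
★ `res_exhaustion_le_closure_of_record` (§2 with `T := (Sc ⊓ Aᗮ)ᗮ`, closed ★ `Submodule.isClosed_orthogonal`). [cite: BrockerTomDieck1985, III (5.7), Thm. (5.10)] [cite: DeitmarEchterhoff2014, §7.3]
[cite: BorelJacquet1979, §4.1, §4.6] -/
theorem hNblk_of_kTypes (𝔓 : (quasiSplit (↥(maximalRealSubfield L)) L (IsCMField.complexConj L) 3).ParabolicUnipotentData) (Kf : {Kf : Subgroup ↥(finAdelic (↥(maximalRealSubfield L)) L (IsCMField.complexConj L) 3 ((StdForm.antidiagonal 3).over L)) // IsOpen ((Kf : Subgroup ↥(finAdelic (↥(maximalRealSubfield L)) L (IsCMField.complexConj L) 3 ((StdForm.antidiagonal 3).over L))) : Set ↥(finAdelic (↥(maximalRealSubfield L)) L (IsCMField.complexConj L) 3 ((StdForm.antidiagonal 3).over L))) ∧ Kf ≤ ((((standardMaximalCompactGL 3 L).comap (adelicVal (↥(maximalRealSubfield L)) L (IsCMField.complexConj L) 3 ((StdForm.antidiagonal 3).over L)) : Subgroup (quasiSplit (↥(maximalRealSubfield L)) L (IsCMField.complexConj L) 3).Adelic)).comap (finAdelicToAdelic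 (↥(maximalRealSubfield L)) L (IsCMField.complexConj L) 3 ((StdForm.antidiagonal 3).over L)) : Subgroup ↥(finAdelic (↥(maximalRealSubfield L)) L (IsCMField.complexConj L) 3 ((StdForm.antidiagonal 3).over L)))})
    (χ₁ : HeckeCharacter L) (χ₂ : ↥(TorusDict.torus (IsCMField.complexConj L)) →ₜ* ℂˣ) (A : Submodule ℂ ((quasiSplit (↥(maximalRealSubfield L)) L (IsCMField.complexConj L) 3).L2 μ))
    (hτ : ∀ (τ : {U : ClosedSubrep (((quasiSplit (↥(maximalRealSubfield L)) L (IsCMField.complexConj L) 3).rightRegular μ).restrict ((archToAdelic (↥(maximalRealSubfield L)) L (IsCMField.complexConj L) 3 ((StdForm.antidiagonal 3).over L)).comp (Subgroup.inclusion (inf_le_left : (UnitaryGroup.arch (↥(maximalRealSubfield L)) L (IsCMField.complexConj L) 3 ((StdForm.antidiagonal 3).over L) ⊓ unitaryGroupOfForm (conjMixed (↥(maximalRealSubfield L)) L (IsCMField.complexConj L)) 1) ≤ UnitaryGroup.arch (↥(maximalRealSubfield L)) L (IsCMField.complexConj L) 3 ((StdForm.antidiagonal 3).over L))))) // U.toContRep.IsTopIrreducible})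 (W : ClosedSubrep ((quasiSplit (↥(maximalRealSubfield L)) L (IsCMField.complexConj L) 3).rightRegular μ)), W.toContRep.IsTopIrreducible →
      W ≤ residualSubspace (quasiSplit (↥(maximalRealSubfield L)) L (IsCMField.complexConj L) 3) μ 𝔓 →
        W.toSubmodule ⊓ ((⨅ u : ↥(Kf.1), Module.End.eigenspace ((((quasiSplit (↥(maximalRealSubfield L)) L (IsCMField.complexConj L) 3).rightRegular μ) (finAdelicToAdelic (↥(maximalRealSubfield L)) L (IsCMField.complexConj L) 3 ((StdForm.antidiagonal 3).over L) (u : ↥(finAdelic (↥(maximalRealSubfield L)) L (IsCMField.complexConj L) 3 ((StdForm.antidiagonal 3).over L)))) :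
        (quasiSplit (↥(maximalRealSubfield L)) L (IsCMField.complexConj L) 3).L2 μ →L[ℂ] (quasiSplit (↥(maximalRealSubfield L)) L (IsCMField.complexConj L) 3).L2 μ) : (quasiSplit (↥(maximalRealSubfield L)) L (IsCMField.complexConj L) 3).L2 μ →ₗ[ℂ] (quasiSplit (↥(maximalRealSubfield L)) L (IsCMField.complexConj L) 3).L2 μ) 1) ⊓ ((((quasiSplit (↥(maximalRealSubfield L)) L (IsCMField.complexConj L) 3).rightRegular μ).restrict ((archToAdelic (↥(maximalRealSubfield L)) L (IsCMField.complexConj L) 3 ((StdForm.antidiagonal 3).over L)).comp (Subgroup.inclusion (inf_le_left : (UnitaryGroup.arch (↥(maximalRealSubfield L)) L (IsCMField.complexConj L) 3 ((StdForm.antidiagonal 3).over L) ⊓ unitaryGroupOfForm (conjMixed (↥(maximalRealSubfield L)) L (IsCMField.complexConj L)) 1) ≤ UnitaryGroup.arch (↥(maximalRealSubfield L)) L (IsCMField.complexConj L) 3 ((StdForm.antidiagonal 3).over L))))).isotypicComponent τ.1.toContRep).toSubmodule) ≤ (resGBlock L μ (Kf.1.map (finAdelicToAdelic (↥(maximalRealSubfield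 L)) L (IsCMField.complexConj L) 3 ((StdForm.antidiagonal 3).over L))) 1 χ₁ χ₂ ⊓ Aᗮ)ᗮ) :
    ∀ W : ClosedSubrep ((quasiSplit (↥(maximalRealSubfield L)) L (IsCMField.complexConj L) 3).rightRegular μ), W.toContRep.IsTopIrreducible → W ≤ residualSubspace (quasiSplit (↥(maximalRealSubfield L)) L (IsCMField.complexConj L) 3) μ 𝔓 →
      W.toSubmodule ⊓ (⨅ u : ↥(Kf.1), Module.End.eigenspace ((((quasiSplit (↥(maximalRealSubfield L)) L (IsCMField.complexConj L) 3).rightRegular μ) (finAdelicToAdelic (↥(maximalRealSubfield L)) L (IsCMField.complexConj L) 3 ((StdForm.antidiagonal 3).over L) (u : ↥(finAdelic (↥(maximalRealSubfield L)) L (IsCMField.complexConj L) 3 ((StdForm.antidiagonal 3).over L)))) :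
        (quasiSplit (↥(maximalRealSubfield L)) L (IsCMField.complexConj L) 3).L2 μ →L[ℂ] (quasiSplit (↥(maximalRealSubfield L)) L (IsCMField.complexConj L) 3).L2 μ) : (quasiSplit (↥(maximalRealSubfield L)) L (IsCMField.complexConj L) 3).L2 μ →ₗ[ℂ] (quasiSplit (↥(maximalRealSubfield L)) L (IsCMField.complexConj L) 3).L2 μ) 1) ≤ (resGBlock L μ (Kf.1.map (finAdelicToAdelic (↥(maximalRealSubfield L)) L (IsCMField.complexConj L) 3 ((StdForm.antidiagonal 3).over L))) 1 χ₁ χ₂ ⊓ Aᗮ)ᗮ := by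
  intro W hW hres
  haveI : CompactSpace ↥(UnitaryGroup.arch (↥(maximalRealSubfield L)) L (IsCMField.complexConj L) 3 ((StdForm.antidiagonal 3).over L) ⊓ unitaryGroupOfForm (conjMixed (↥(maximalRealSubfield L)) L (IsCMField.complexConj L)) 1) := compactSpace_arch_inf_unitaryOne L 3 ((StdForm.antidiagonal 3).over L)
  exact inf_fix_le_of_forall_kType μ (Subgroup.inclusion (inf_le_left : (UnitaryGroup.arch (↥(maximalRealSubfield L)) L (IsCMField.complexConj L) 3 ((StdForm.antidiagonal 3).over L) ⊓ unitaryGroupOfForm (conjMixed (↥(maximalRealSubfield L)) L (IsCMField.complexConj L)) 1) ≤ UnitaryGroup.arch (↥(maximalRealSubfield L)) L (IsCMField.complexConj L) 3 ((StdForm.antidiagonal 3).over L))) (continuous_inclusion_arch_inf_unitaryOne L 3 ((StdForm.antidiagonal 3).over L)) W Kf.1 _ (Submodule.isClosed_orthogonal _)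
    fun τ => hτ τ W hW hres

end Record

end Summit.HodgeConjecture.HodgeConjecture.R90.S8

end
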